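import Summits.NavierStokesRegularity.NavierStokesRegularity.Theorems.TypeILiouvilleTypeIliouvilleLWeakL3Recurrence
import Summits.NavierStokesRegularity.NavierStokesRegularity.Theorems.TypeILiouvilleTypeIliouvilleLPersistentLpRecurrence
import Literature.Analysis.FluidPDE.SteadyNSBoundedMild
import HarnessLib

/-!
# The bounded steady Liouville problem inside S3ᵐ, in the `Lᵖ` and weak-`L³` currencies
# (crux `TypeIliouvilleL`, stmt-NavierStokesRegularity-10661)

Helper file (theorems only, no definition, no named fact, no `sorry`; lands
`--supports stmt-NavierStokesRegularity-10661`). The persistent stub S3ᵐ of the crux "contains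
every bounded non-constant steady mild solution in `ℝ³` as a potential counterexample" (stub
docstring; KNSS 2009 p. 3: (L) is open "even in the steady-state case"). This file puts the steady
case in the currencies of `…PersistentLpRecurrence` / `…WeakL3Recurrence`:

* `steady_printsClass` — a steady classical solution `(W,P)` of unforced Navier–Stokes (`ν = 1`)
  on `ℝ³` with bounded velocity, read as the constant-in-time field `t ↦ W`, is in print's class
  of mild bounded ancient solutions: continuous, bounded, weakly divergence free, and Oseen-mild for
  all `s < t < 0` (`IsSteadyClassicalNS.eq_heatExtension_sub_oseenDuhamel` + time translation of
  the Duhamel term);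
* `steady_eq_const_of_eLpNorm_sub_const_lt_top` — **if `W − b ∈ Lᵖ(ℝ³)` for ONE constant `b` and
  ONE `0 < p ≤ 3`, then `W ≡ b`**; `steady_eLpNorm_sub_const_eq_top_of_ne_const` — a non-constant
  bounded steady flow has `‖W − b‖_{Lᵖ} = ∞` for every constant `b` and every `p ≤ 3`;
* `steady_eq_const_of_weakL3_sub_const` — the weak-`L³` version (uniform stream `+ O(|x|⁻¹)`
  wake shape): `s³·vol{‖W − b‖ > s} ≤ M` plus Albritton–Barker's `𝔹`-conditions for `W − b`
  ((a) heat form, (b) blow-down for the relevant translate) force `W ≡ b`.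

Honest comparison: for `b = 0` the tree's Galdi theorem (`galdi_liouville_nineHalves_holds`) with
`L^p ∩ L^∞ ⊂ L^{9/2}` is stronger (`p ≤ 9/2`); the content here is the NON-ZERO uniform stream `b`
(flows settling to a uniform stream at infinity in an `Lᵖ` / weak-`L³` sense) and the uniform
treatment with the ancient case. Nothing here proves the bounded steady Liouville problem, S3ᵐ,
(L), or anything about Navier–Stokes regularity.
-/

set_option linter.dupNamespace false

namespace Summit.NavierStokesRegularity.NavierStokesRegularity.Theorems

open MeasureTheory Filter Set Function
open scoped ENNReal NNReal Topology RealInnerProductSpace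
open Literature.Analysis Literature.Analysis.FluidPDE

namespace TypeIliouvilleL.SteadyCurrency

/-- **Bounded steady classical flows are in print's mild class** (as constant-in-time fields on
`(−∞,0) × ℝ³`): continuous, bounded, weakly divergence free, Oseen-mild for all `s < t < 0`.
[cite: KochNadirashviliSereginSverak2009, §3 Lemma 3.1 and §1 p. 3 (arXiv:0709.3599)] -/
theorem steady_printsClass
    {W : EuclideanSpace ℝ (Fin 3) → EuclideanSpace ℝ (Fin 3)} {P : EuclideanSpace ℝ (Fin 3) → ℝ}
    (hW : IsSteadyClassicalNS 1 0 W P) (hbd : ∃ M : ℝ, ∀ x, ‖W x‖ ≤ M) :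
    ContinuousOn (uncurry (fun _ : ℝ => W)) (Iio 0 ×ˢ univ) ∧
    (∃ K : ℝ, ∀ t < 0, ∀ x, ‖(fun _ : ℝ => W) t x‖ ≤ K) ∧
    (∀ t < 0, IsWeaklyDivFree ((fun _ : ℝ => W) t)) ∧
    (∀ s t : ℝ, s < t → t < 0 → ∀ x,
      (fun _ : ℝ => W) t x =
        UnboundedOperators.heatExtension ((fun _ : ℝ => W) s) (t - s) x -
          oseenDuhamel 1 s (fun _ : ℝ => W) (fun _ : ℝ => W) t x) := by
  obtain ⟨M, hM⟩ := hbd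
  have hWc : Continuous W := hW.smooth_velocity.continuous
  refine ⟨(hWc.comp continuous_snd).continuousOn, ⟨M, fun _ _ x => hM x⟩, fun _ _ => ?_, ?_⟩
  · exact VectorCalculus.IsDivFree.isWeaklyDivFree_holds hW.divFree
      (contDiff_infty.1 hW.smooth_velocity 1)
  · intro s t hst _ x
    have h1 := hW.eq_heatExtension_sub_oseenDuhamel hM (τ := t - s) (sub_pos.2 hst) x
    -- time translation of the Duhamel term of a constant-in-time field
    have h2 : oseenDuhamel 1 s (fun _ : ℝ => W) (fun _ : ℝ => W) t x =
        oseenDuhamel 1 0 (fun _ : ℝ => W) (fun _ : ℝ => W) (t - s) x := by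
      have h := oseenDuhamel_translate 1 s (-s) (fun _ : ℝ => W) (fun _ : ℝ => W) t x
      rw [add_neg_cancel, ← sub_eq_add_neg] at h
      exact h
    rw [h2]
    exact h1

end TypeIliouvilleL.SteadyCurrency

open TypeIliouvilleL.SteadyCurrency

/-- **A bounded steady flow that differs from a uniform stream by an `Lᵖ` field, `0 < p ≤ 3`,
is the uniform stream.** If `(W,P)` is a steady classical solution of unforced Navier–Stokes
(`ν = 1`) on `ℝ³` with bounded velocity and `‖W − b‖_{Lᵖ(ℝ³)} < ∞` for one constant `b` and one
`0 < p ≤ 3`, then `W x = b` for all `x` (the constant-in-time field is `Lᵖ`-close to `b` along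
`τ_k = −(k+1)`; `oseenMild_const_of_backward_Lp_const`).
[cite: AlbrittonBarker2019, Thm 1.2 (arXiv:1811.00502 p. 4)] -/
theorem steady_eq_const_of_eLpNorm_sub_const_lt_top
    {W : EuclideanSpace ℝ (Fin 3) → EuclideanSpace ℝ (Fin 3)} {P : EuclideanSpace ℝ (Fin 3) → ℝ}
    (hW : IsSteadyClassicalNS 1 0 W P) (hbd : ∃ M : ℝ, ∀ x, ‖W x‖ ≤ M)
    (b : EuclideanSpace ℝ (Fin 3)) {p : ℝ≥0∞} (hp0 : p ≠ 0) (hp3 : p ≤ 3)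
    (hLp : eLpNorm (fun x => W x - b) p (volume : Measure (EuclideanSpace ℝ (Fin 3))) < ∞) :
    ∀ x, W x = b := by
  obtain ⟨hc, hK, hd, hm⟩ := steady_printsClass hW hbd
  have hτlim : Tendsto (fun k : ℕ => -((k : ℝ) + 1)) atTop atBot :=
    tendsto_neg_atTop_atBot.comp (tendsto_natCast_atTop_atTop.atTop_add tendsto_const_nhds)
  have h := oseenMild_const_of_backward_Lp_const (fun _ : ℝ => W) b hp0 hp3 hc hK hd hm
    ⟨fun k : ℕ => -((k : ℝ) + 1), eLpNorm (fun x => W x - b) p volume, hLp, hτlim,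
      fun k => by
        have : (0 : ℝ) ≤ k := Nat.cast_nonneg k
        linarith,
      fun _ => le_rfl⟩
  exact fun x => h (-1) (by norm_num) x

/-- **Non-constant bounded steady flows are infinitely far in every `Lᵖ`, `p ≤ 3`, from every
uniform stream**: if `W` is not identically `b` then `‖W − b‖_{Lᵖ(ℝ³)} = ∞` for all `0 < p ≤ 3`.
[cite: AlbrittonBarker2019, Thm 1.2 (arXiv:1811.00502 p. 4)] -/
theorem steady_eLpNorm_sub_const_eq_top_of_ne_const
    {W : EuclideanSpace ℝ (Fin 3) → EuclideanSpace ℝ (Fin 3)} {P : EuclideanSpace ℝ (Fin 3) → ℝ}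
    (hW : IsSteadyClassicalNS 1 0 W P) (hbd : ∃ M : ℝ, ∀ x, ‖W x‖ ≤ M)
    (b : EuclideanSpace ℝ (Fin 3)) {p : ℝ≥0∞} (hp0 : p ≠ 0) (hp3 : p ≤ 3)
    (hne : ∃ x, W x ≠ b) :
    eLpNorm (fun x => W x - b) p (volume : Measure (EuclideanSpace ℝ (Fin 3))) = ∞ := by
  by_contra hfin
  obtain ⟨x, hx⟩ := hne
  exact hx (steady_eq_const_of_eLpNorm_sub_const_lt_top hW hbd b hp0 hp3
    (lt_top_iff_ne_top.2 hfin) x)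

/-- **Weak-`L³` version: uniform stream + `O(|x|⁻¹)`-class wake.** If `(W,P)` is a steady classical
solution of unforced Navier–Stokes (`ν = 1`) on `ℝ³` with bounded velocity, `W − b` is in
weak-`L³` (`s³·vol{x : s < ‖W x − b‖} ≤ M < ∞` for all `s > 0`) and satisfies Albritton–Barker's
`𝔹`-conditions — (a) `√σ ‖e^{σΔ}(W − b)(x)‖ ≤ A` for all `σ > 0`, `x`, and (b)
`∫ ⟪λ (W(λx − b) − b), φ(x)⟫ dx → 0` as `λ → ∞` for all test fields `φ` (the translate by
`t₀b`, `t₀ = −1`, seen by the Galilean boost) — then `W ≡ b`.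
[cite: AlbrittonBarker2019, Thm 4.1 (arXiv:1811.00502 §4 p. 9)] -/
theorem steady_eq_const_of_weakL3_sub_const
    {W : EuclideanSpace ℝ (Fin 3) → EuclideanSpace ℝ (Fin 3)} {P : EuclideanSpace ℝ (Fin 3) → ℝ}
    (hW : IsSteadyClassicalNS 1 0 W P) (hbd : ∃ M : ℝ, ∀ x, ‖W x‖ ≤ M)
    (b : EuclideanSpace ℝ (Fin 3))
    (hwk : ∃ M : ℝ≥0∞, M < ∞ ∧ ∀ s : ℝ, 0 < s →
      ENNReal.ofReal s ^ 3 * (volume : Measure (EuclideanSpace ℝ (Fin 3))) {x | s < ‖W x - b‖} ≤ M)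
    (hA : ∃ A : ℝ, ∀ σ : ℝ, 0 < σ → ∀ x,
      Real.sqrt σ * ‖UnboundedOperators.heatExtension (fun y => W y - b) σ x‖ ≤ A)
    (hB : ∀ φ : EuclideanSpace ℝ (Fin 3) → EuclideanSpace ℝ (Fin 3),
      FunctionSpaces.IsTestFunctionOn (⊤ : TopologicalSpace.Opens (EuclideanSpace ℝ (Fin 3))) φ →
      Tendsto (fun lam : ℝ => ∫ x, ⟪lam • (W (lam • x + (-1 : ℝ) • b) - b), φ x⟫) atTop (𝓝 0)) :
    ∀ x, W x = b := by
  obtain ⟨hc, hK, hd, hm⟩ := steady_printsClass hW hbd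
  obtain ⟨M, hM, hwk⟩ := hwk
  have hτlim : Tendsto (fun k : ℕ => -((k : ℝ) + 1)) atTop atBot :=
    tendsto_neg_atTop_atBot.comp (tendsto_natCast_atTop_atTop.atTop_add tendsto_const_nhds)
  have h := oseenMild_const_of_backward_weakL3_const (fun _ : ℝ => W) b hc hK hd hm
    ⟨fun k : ℕ => -((k : ℝ) + 1), M, hM, hτlim,
      fun k => by
        have : (0 : ℝ) ≤ k := Nat.cast_nonneg k
        linarith,
      fun _ s hs => hwk s hs⟩ (t₀ := -1) (by norm_num) hA hB
  exact fun x => h (-1) le_rfl x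

end Summit.NavierStokesRegularity.NavierStokesRegularity.Theorems
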